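import Summits.BirchSwinnertonDyer.BirchSwinnertonDyer.Theorems.GoldfeldAllTwistsTwoConverseTwinQuarterTraceChiZCore
import Summits.BirchSwinnertonDyer.BirchSwinnertonDyer.Theorems.GoldfeldAllTwistsTwoConverseTwinQuarterTraceChiZPrep
import Summits.BirchSwinnertonDyer.BirchSwinnertonDyer.Theorems.GoldfeldAllTwistsTwoConverseTwinQuarterTraceSignaturesEAlphaPlusPLiftModFourAlpha
import Summits.BirchSwinnertonDyer.BirchSwinnertonDyer.Theorems.GoldfeldAllTwistsTwoConverseTwinQuarterTraceSignaturesPAlphaThreeModEightModFourAlpha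
import Summits.BirchSwinnertonDyer.BirchSwinnertonDyer.Theorems.GoldfeldAllTwistsTwoConverseTwinQuarterTraceSignaturesQPModFourAlpha
import Summits.BirchSwinnertonDyer.BirchSwinnertonDyer.Theorems.GoldfeldAllTwistsTwoConverseTwinQuarterTraceChiZNonTorsion
import Summits.BirchSwinnertonDyer.BirchSwinnertonDyer.Theorems.GoldfeldAllTwistsTwoConverseTwinQuarterTraceChiZAlpha
import Summits.BirchSwinnertonDyer.BirchSwinnertonDyer.Theorems.GoldfeldAllTwistsTwoConverseTwinQuarterTracePartnerPHeightModFour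
import HarnessLib

set_option linter.dupNamespace false -- namespace `…BirchSwinnertonDyer.BirchSwinnertonDyer…` is the cell's (D-0017 nested layout)
set_option autoImplicit false

/-!
# OBJECT A3⁺, file T4: `…QuarterTraceChiZAlphaThreeModEightPlus` — the QUARTER POINT with **`χ_Z(σ̃_p) = T`** on the type-α cells a31+ ∪ a35+
# (`q ≡ 3 (mod 8)`, `q > 3`, `(q/7) = −1`; `p ≡ 1 (mod 4)`, `(−7/p) = +1`, `−7 ∉ 𝔽_p^{×4}`; **`(p/q) = +1`**) WITHOUT `h2`, and the conductor-`1` Heegner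
# trace is NON-TORSION by the χ_Z channel (Z1)

Cell `bsd-goldfeld`, seat `bsd-goldfeld-s1p-c3x` (gen 17), memo `HOME/A3PLUS-CHIZ-ALPHA.md`. TWIN of C7A-Z2 `…QuarterTraceChiZAlphaModFourAlpha` (the `σ̃_p`
quarter point at `(p/q) = −1`, `q ≡ 7 (mod 8)`). STATEMENT DELTA (exactly): `hq8 : q % 8 = 7` ↦ **`hq8 : q % 8 = 3`, `h3 : 3 < q`**; binder
`h4e : ∀ Δ, Δ.D = −qp → ¬ 4 ∣ #Cl(𝒪_Δ)` ↦ **`hpq : jacobiSym p q = 1`**; binder **`h2` DROPPED**. PACKAGES: χ_q X3a `exists_chiQ_package_L_modFourAlpha`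
(`σ̃_pY = Y`: `s_Y(σ̃_p) = 0`) unchanged; χ_p ↦ T2 `exists_chiP_package_alpha_L_threeModEight_modFourAlpha` (**`s_p(σ̃_p) = 1`**: A‴'s flipped half-trace
law); χ_e ↦ T3 `exists_chiE_package_alpha_L_plusPLift_modFourAlpha` (**`s_e(σ̃_p) = 0`** in BOTH Gross–Zagier branches of `49a1^{(−qp)}`: `κ_F` even at
`(p/q) = +1`, resp. `P_e` torsion). §0 (NEW, fact-free group algebra) `exists_odd_zsmul_map_sub_eq_twoTorsion_threeModEightPlus` = X4's core with the
signature vector `(s_Y, s_p, s_e)(σ̃_p) = (0, 1, 0)` — a PERMUTATION of C4/C7A's `(0, 0, 1)` — and `[η_{σ̃_p}]₂ = O` (X1 §5 / X2's key lemma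
`exists_odd_zsmul_cosetEta_eq_zero`, verbatim): `χ_Z(σ̃_p) = O + T + O = T`. §1 `exists_quarterPoint_chiZ_alpha_threeModEightPlus`, §2
`heegnerTrace_not_isOfFinAddOrder_alpha_threeModEightPlus` = Z1 ∘ §1. WHY NOT `σ̃_q` (A7⁺'s lift): there `χ_Z(σ̃_q) = [h2]` needs `h2`, i.e. a
(2,4) descent of `49a1^{(−qp)}` at `q ≡ 3 (mod 8)` + `hBCST` + `hpar`; at `σ̃_p` the value is `T` with FIFTEEN prints and no descent. The same
formula predicts `χ_Z(σ̃_p) = O` on a71+/a75+ (why A7⁺ used `σ̃_q`) and `χ_Z = 0` on C1/C2 under `h2` (the barrier cells) — memo §1.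
`--supports stmt-BirchSwinnertonDyer-20044 --as helper` (rank axis). Theses-free; theorems only; no definition, no new fact, no `sorry`. Binders BY NAME as
in the source. FRONTIER-grade: twist-density-ZERO sub-family modulo named print; never distance-to-summit. HONEST FRAMING: items 19350 / 19140 / 20044
unchanged; BSD is not proved by any of this.
-/

noncomputable section

open scoped Classical IntermediateField

open WeierstrassCurve NumberField Literature.NumberTheory Literature.NumberTheory.EllipticCurves
  Literature.NumberTheory.EllipticCurves.ModularForms Literature.NumberTheory.EllipticCurves.CaiShuTian2014
  Literature.NumberTheory.EllipticCurves.CoatesLiTianZhai2015 Literature.Computability.Cryptography.Hallgren2005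

namespace Summit.BirchSwinnertonDyer.BirchSwinnertonDyer.Theorems.GoldfeldGoodTwists

/-! ## §0 X4's core at the lift `σ̃_p` with the signature vector `(s_Y, s_p, s_e) = (0, 1, 0)` -/
section ChiZCore

variable {M : Type*} [AddCommGroup M]

/-- **The cocycle value `χ_Z(σ̃_p) = T` on the `q ≡ 3 (mod 8)` α⁺ cells** (X4's core, signatures permuted). With
`Z = N•Ψ − N_e•R_e − N_q•Y − N_p•R_p` (`N_p` odd), `σY = Y`, `k_p•(σR_p + R_p) = T`, `k_e•(σR_e + R_e) = 0` and the key lemma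
`k•(N•(σΨ − Ψ) + 2N_e•R_e + 2N_p•R_p) = 0` (`k_p, k_e, k` odd): `σ(n•Z) − n•Z = T` for the odd `n = k·k_e·k_p`.
[cite: GrossLMS1991, Prop. 5.3] [cite: CoatesLiTianZhai2015, Thm. 2.5] -/
theorem exists_odd_zsmul_map_sub_eq_twoTorsion_threeModEightPlus (σ : M →+ M) {T : M} (hT2 : 2 • T = 0)
    {Z Ψ Y Re Rp : M} {N Ne Nq Np : ℤ} (hNp : Odd Np) (hZ : Z = N • Ψ - Ne • Re - Nq • Y - Np • Rp) (hY : σ Y = Y)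
    (hRp : ∃ k : ℤ, Odd k ∧ k • (σ Rp + Rp) = T) (hRe : ∃ k : ℤ, Odd k ∧ k • (σ Re + Re) = 0)
    (hKey : ∃ k : ℤ, Odd k ∧ k • (N • (σ Ψ - Ψ) + (2 * Ne) • Re + (2 * Np) • Rp) = 0) :
    ∃ n : ℤ, Odd n ∧ σ (n • Z) - n • Z = T := by
  obtain ⟨kp, hkp, hkpT⟩ := hRp
  obtain ⟨ke, hke, hke0⟩ := hRe
  obtain ⟨k, hk, hk0⟩ := hKey
  refine ⟨k * ke * kp, (hk.mul hke).mul hkp, ?_⟩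
  -- `σZ − Z = [N(σΨ − Ψ) + 2N_eR_e + 2N_pR_p] − N_e(σR_e + R_e) − N_p(σR_p + R_p)` (using `σY = Y`)
  have hdiff : σ Z - Z = (N • (σ Ψ - Ψ) + (2 * Ne) • Re + (2 * Np) • Rp) - Ne • (σ Re + Re) - Np • (σ Rp + Rp) := by
    rw [hZ]
    simp only [map_sub, map_zsmul, hY, zsmul_sub, smul_add, mul_zsmul, two_zsmul]
    abel
  rw [map_zsmul, ← zsmul_sub, hdiff, zsmul_sub, zsmul_sub]
  rw [show (k * ke * kp) • (N • (σ Ψ - Ψ) + (2 * Ne) • Re + (2 * Np) • Rp) = 0 by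
        rw [show k * ke * kp = (ke * kp) * k by ring, mul_zsmul, hk0, zsmul_zero],
      show (k * ke * kp) • (Ne • (σ Re + Re)) = 0 by
        rw [smul_smul, show k * ke * kp * Ne = (k * kp * Ne) * ke by ring, mul_zsmul, hke0, zsmul_zero],
      show (k * ke * kp) • (Np • (σ Rp + Rp)) = T by
        rw [smul_smul, show k * ke * kp * Np = (k * ke * Np) * kp by ring, mul_zsmul, hkpT,
          zsmul_twoTorsion_of_odd hT2 ((hk.mul hke).mul hNp)]]
  rw [sub_self, zero_sub]
  exact neg_eq_iff_add_eq_zero.mpr (by rw [← two_nsmul]; exact hT2)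

end ChiZCore

-- the cell's point-group world over `K[1]` / `ℂ` (A⁗_α's, X1's); file-local
attribute [local instance 2000] Classical.propDecidable

/-! ## §1 The quarter point of the α cell (`q ≡ 3 (mod 8)`, `(p/q) = +1`) in `X₀(49)(K[1])` and its χ_Z-signature `σ̃_p(n•Z) − n•Z = T`, NO `h2` -/
section QuarterPoint
variable {K : Type} [Field K] [NumberField K] (ι : K →+* ℂ) [FiniteDimensional K (ringClassField K ι 1)]
  [IsGalois K (ringClassField K ι 1)] [NumberField (ringClassField K ι 1)]

/-- **The quarter point with `χ_Z(σ̃_p) = T`, type α, `q ≡ 3 (mod 8)`, `(p/q) = +1` — WITHOUT `h2`.** Packages: the χ_q package X3a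
(`exists_chiQ_package_L_modFourAlpha`, `s_Y(σ̃_p) = 0`: `σ̃_pY = Y`), T2's χ_p package (`s_p(σ̃_p) = 1`), T3's h2-free χ_e package (`s_e(σ̃_p) = 0`); carry
binders `hA`, `har` (THEOREM A‴'s statements), `hpq`, `hSK` and the genus subgroup data as in A⁗_α; for a lift `σ̃` (`σ̃r_q = r_q`, `σ̃r_p = −r_p`): an odd
`N`, `Z`, `t ∈ {O, T}` with `4•Z = N•Σ_σ σy_K + t` and an odd `n` with `σ̃(n•Z) − n•Z = T`. [cite: Gross1984, §§4–5] [cite: GrossLMS1991, Prop. 5.3]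
[cite: CoatesLiTianZhai2015, Thm. 1.3, 1.4, 4.4 and (2.8)] -/
theorem exists_quarterPoint_chiZ_alpha_threeModEightPlus (hEta₀ : x049_x_sub_two_eq_etaQuotient) (hD : deuring_etaQuotient49_heegner_generates_conjPrime)
    (hEta : x049_heegner_norm_x_sub_two_not_mem) (h14 : thm14_rankOne_twist) (hCST : thm11_ringClassChar)
    (hGZ : ∀ (N : ℕ) [NeZero N] (W : WeierstrassCurve ℚ) (K : Type) [Field K] [NumberField K], gross_zagier N W K)
    (h12 : thm12_fullBSD_twist) (h44 : thm44_ord_two_LAlg)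
    (hS31 : bsdTriple_of_rank_le_one_of_conductor_lt) (hnew : exists_isNewformOf)
    (hBT : burungaleTian_analyticRank_eq_zero_of_selmerCorank_eq_zero_of_hasCM) (hBF : bsdTriple_of_hasCM_of_L_one_ne_zero)
    (hGZK : rank_eq_analyticRank_of_analyticRank_le_one)
    (hK : IsImaginaryQuadratic K) {q p : ℕ} (hq : q.Prime) (hq8 : q % 8 = 3) (h3 : 3 < q) (hq7 : jacobiSym q 7 = -1)
    [Fact p.Prime] (hp4 : p % 4 = 1) (hp7 : legendreSym p (-7) = 1) (hα : ¬ ∃ x : ZMod p, x ^ 4 = -7)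
    (hpq : jacobiSym (p : ℤ) q = 1)
    (hA : ∀ (K₂ : Type) [Field K₂] [NumberField K₂], IsImaginaryQuadratic K₂ → NumberField.discr K₂ = -(8 * (q : ℤ)) →
      ∀ P : (cm7.baseChange K₂).toAffine.Point, IsHeegnerPoint 49 cm7 K₂ P → ¬ IsOfFinAddOrder P)
    (har : ∀ (W : WeierstrassCurve ℚ) [W.IsElliptic] (C : VariableChange ℚ),
      C • W = cm7.quadraticTwist ((-2 * q : ℤ) : ℚ) → W.analyticRank = 1)
    (hdK : NumberField.discr K = -(8 * (q : ℤ) * p))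
    (D₀ : ModularParametrizationData cm7 49) (hc : |D₀.c| = 1) (hw : cm7.rootNumber = 1)
    (h0 : ∃ h, D₀.cuspZeroPoint = Affine.Point.some 2 (-1) h)
    {β : ℤ} (d : KolyvaginHeegnerData D₀ β ι 1) {rq rp : ringClassField K ι 1}
    (hrq : (rq : ℂ) ^ 2 = -(q : ℂ)) (hrp : (rp : ℂ) ^ 2 = (p : ℂ))
    (B : AddSubgroup (cm7.baseChange ℂ).toAffine.Point) (S : Subfield ℂ)
    (hBfix : ∀ P : (cm7.baseChange (ringClassField K ι 1)).toAffine.Point,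
      (∀ σ : ringClassField K ι 1 ≃ₐ[K] ringClassField K ι 1, σ rq = rq → σ rp = rp →
        Affine.Point.map (σ : ringClassField K ι 1 →ₐ[K] ringClassField K ι 1) P = P) →
      Affine.Point.map (W' := cm7) (ringClassField K ι 1).subtype.toRatAlgHom P ∈ B)
    (hBodd : ∀ u ∈ B, IsOfFinAddOrder u → ∃ n : ℤ, Odd n ∧
      (n • u = 0 ∨ n • u = Affine.Point.some 2 (-1) (nonsingular_cm7_baseChange_two_neg_one ℂ)))
    (hBS : ∀ (E : Type) [Field E] [CharZero E] (e : E →+* ℂ), e.fieldRange ≤ S →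
      ∀ z : (cm7.baseChange E).toAffine.Point, Affine.Point.map (W' := cm7) e.toRatAlgHom z ∈ B)
    (hSK : ∀ k : K, ι k ∈ S) (hSq : (rq : ℂ) ∈ S) (hSp : (rp : ℂ) ∈ S)
    (hBL : ∀ z ∈ B, ∃ P : (cm7.baseChange (ringClassField K ι 1)).toAffine.Point,
      Affine.Point.map (W' := cm7) (ringClassField K ι 1).subtype.toRatAlgHom P = z)
    (h7 : ¬ IsSquare (-7 : ringClassField K ι 1)) (h7' : ¬ IsSquare (7 : ringClassField K ι 1))
    (σt : ringClassField K ι 1 ≃ₐ[K] ringClassField K ι 1) (hσq : σt rq = rq) (hσp : σt rp = -rp) :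
    ∃ (N : ℤ) (Z t : (cm7.baseChange (ringClassField K ι 1)).toAffine.Point), Odd N ∧
      (t = 0 ∨ t = Affine.Point.some 2 (-1) (nonsingular_cm7_baseChange_two_neg_one (ringClassField K ι 1))) ∧
      (4 : ℤ) • Z = N • (∑ σ : ringClassField K ι 1 ≃ₐ[K] ringClassField K ι 1,
          Affine.Point.map (σ : ringClassField K ι 1 →ₐ[K] ringClassField K ι 1) d.y) + t ∧
      ∃ n : ℤ, Odd n ∧ Affine.Point.map (σt : ringClassField K ι 1 →ₐ[K] ringClassField K ι 1) (n • Z) - n • Z =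
        Affine.Point.some 2 (-1) (nonsingular_cm7_baseChange_two_neg_one (ringClassField K ι 1)) := by
  haveI : (cm7.baseChange (ringClassField K ι 1)).IsElliptic := by rw [WeierstrassCurve.baseChange]; infer_instance
  have hp : p.Prime := Fact.out
  obtain ⟨hq4, -, -⟩ := mod_eight_eq_three_arith hq8
  have hrK := sq_eq_algebraMap_neg_natCast (ι := ι) hrq
  have hrpK := sq_eq_algebraMap_natCast' (ι := ι) hrp
  have hpL : (p : ringClassField K ι 1) ≠ 0 := by exact_mod_cast hp.ne_zero
  have hrp0 : rp ≠ 0 := by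
    intro h; rw [h, zero_pow two_ne_zero, map_natCast] at hrpK
    exact hpL hrpK.symm
  have hT2 : 2 • Affine.Point.some 2 (-1) (nonsingular_cm7_baseChange_two_neg_one (ringClassField K ι 1)) = 0 := by
    rw [two_nsmul]; exact cm7_twoTorsion_add_self _
  have h4 : ∀ x : (cm7.baseChange (ringClassField K ι 1)).toAffine.Point, (4 : ℤ) • x = 0 →
      x = 0 ∨ x = Affine.Point.some 2 (-1) (nonsingular_cm7_baseChange_two_neg_one (ringClassField K ι 1)) := fun x hx ↦
    cm7_mem_pair_of_four_zsmul_eq_zero h7 h7' hx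
  ------------------------------------------------------------------ X2's coordinates of `y₁ = d.y` and the non-square partial norms
  obtain ⟨x₁, y₁, hxy, hdy, hX2⟩ := exists_heegner_x_not_isSquare_seven_mul_prod hEta₀ hD hEta hK ι D₀ hc d
  have hx2 : x₁ ≠ 2 := fun h ↦ hX2 {1} (by
    rw [Finset.prod_singleton, AlgEquiv.one_apply, h, sub_self, mul_zero]; exact ⟨0, (mul_zero 0).symm⟩)
  ------------------------------------------------------------------ the three packages over `K[1]` (X3a, X3b-2b)
  obtain ⟨Mq, m, Y, tq, hMq, -, htq, hPq, hYfix, -⟩ := exists_chiQ_package_L_modFourAlpha ι h14 hCST hGZ h44 hBT hBF hnew hK hq h3 hq4 hq7 hp4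
    hp7 hα hdK D₀ hc hw h0 d hrq hrp
  obtain ⟨Mp, Rp, tp, hMp, htp, -, -, hPp, hsigP⟩ := exists_chiP_package_alpha_L_threeModEight_modFourAlpha ι hEta₀ hD hEta hCST hGZ h12 h44 h14 hS31 hnew
    hBT hBF hGZK hK hq hq8 h3 hq7 hp4 hp7 hα hdK hA har D₀ hc hw h0 d hrq hrp B S hBfix hBS hSK hSq hSp hBL
  obtain ⟨Me, Re, te, hMe, hte, -, -, hPe, hsig⟩ := exists_chiE_package_alpha_L_plusPLift_modFourAlpha ι hEta₀ hD hEta h14 hCST hGZ h12 h44 hS31 hnew hBT hBF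
    hGZK hK hq h3 hq4 hq7 hp4 hp7 hα hpq hdK D₀ hc hw h0 d hrq hrp B S hBfix hBodd hBS hSq hSp hBL
  have hte' := cm7_exists_odd_zsmul_mem_pair h7 h7' hte
  have htq' := cm7_exists_odd_zsmul_mem_pair h7 h7' htq
  have htp' := cm7_exists_odd_zsmul_mem_pair h7 h7' htp
  ------------------------------------------------------------------ the quarter trace `Ψ` and the quarter point `Z` (X5-prep)
  obtain ⟨Ψ, hΨ⟩ : ∃ X : (cm7.baseChange (ringClassField K ι 1)).toAffine.Point, X =
      ∑ σ : ringClassField K ι 1 ≃ₐ[K] ringClassField K ι 1, (@ite ℤ (σ rq = rq ∧ σ rp = rp) instDecidableAnd (1 : ℤ) 0) •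
        Affine.Point.map (σ : ringClassField K ι 1 →ₐ[K] ringClassField K ι 1) d.y := ⟨_, rfl⟩
  have hΨ4 : (4 : ℤ) • Ψ = (∑ σ : ringClassField K ι 1 ≃ₐ[K] ringClassField K ι 1,
        Affine.Point.map (σ : ringClassField K ι 1 →ₐ[K] ringClassField K ι 1) d.y) +
      (∑ σ : ringClassField K ι 1 ≃ₐ[K] ringClassField K ι 1,
        ((if σ rq = rq then (1 : ℤ) else -1) * (if σ rp = rp then (1 : ℤ) else -1)) •
          Affine.Point.map (σ : ringClassField K ι 1 →ₐ[K] ringClassField K ι 1) d.y) +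
      (∑ σ : ringClassField K ι 1 ≃ₐ[K] ringClassField K ι 1, (if σ rq = rq then (1 : ℤ) else -1) •
          Affine.Point.map (σ : ringClassField K ι 1 →ₐ[K] ringClassField K ι 1) d.y) +
      (∑ σ : ringClassField K ι 1 ≃ₐ[K] ringClassField K ι 1, (if σ rp = rp then (1 : ℤ) else -1) •
          Affine.Point.map (σ : ringClassField K ι 1 →ₐ[K] ringClassField K ι 1) d.y) := by
    rw [hΨ]
    exact quarterTrace_sum_identity (fun σ : ringClassField K ι 1 ≃ₐ[K] ringClassField K ι 1 ↦ σ rq = rq) (fun σ ↦ σ rp = rp)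
      (fun σ ↦ Affine.Point.map (σ : ringClassField K ι 1 →ₐ[K] ringClassField K ι 1) d.y)
  obtain ⟨n₀, t, hn₀, ht, hZ4⟩ := four_zsmul_quarterPoint hT2 hΨ4 hPe hPq hPp hte' htq' htp'
  obtain ⟨Z, hZ⟩ : ∃ X : (cm7.baseChange (ringClassField K ι 1)).toAffine.Point,
      X = (n₀ * (Me * Mq * Mp)) • Ψ - (n₀ * (Mq * Mp)) • Re - (n₀ * (Me * Mp) * m) • Y - (n₀ * (Me * Mq)) • Rp := ⟨_, rfl⟩
  rw [← hZ] at hZ4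
  ------------------------------------------------------------------ `hKey`: `[η_σ̃]₂ = O` (X1 §5, with X2's key lemma as `hX2`)
  have hPe' := hPe
  have hPp' := hPp
  rw [hdy] at hPe' hPp'
  obtain ⟨kK, hkK, hK0⟩ := exists_odd_zsmul_cosetEta_eq_zero (K := K) hrpK hrp0 hxy hx2 hX2 h4 (hn₀.mul ((hMe.mul hMq).mul hMp))
    (show n₀ * (Me * Mq * Mp) = (n₀ * (Mq * Mp)) * Me by ring) (show n₀ * (Me * Mq * Mp) = (n₀ * (Me * Mq)) * Mp by ring)
    hPe' hPp' hte' htp'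
  rw [← hdy, ← hΨ] at hK0
  -- `σ̃Ψ = Ψ₊₋` (X1 §3)
  have hcos : Affine.Point.map (σt : ringClassField K ι 1 →ₐ[K] ringClassField K ι 1) Ψ =
      ∑ σ : ringClassField K ι 1 ≃ₐ[K] ringClassField K ι 1, (@ite ℤ (σ rq = rq ∧ σ rp = -rp) instDecidableAnd (1 : ℤ) 0) •
        Affine.Point.map (σ : ringClassField K ι 1 →ₐ[K] ringClassField K ι 1) d.y := by
    rw [hΨ]; exact map_quarterSum_eq_cosetSum σt hrK hrpK hrp0 hσq hσp d.y
  ------------------------------------------------------------------ §0's core at `σ̃_p`: `χ_Z(σ̃_p) = O + T + O = T`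
  have hχ := exists_odd_zsmul_map_sub_eq_twoTorsion_threeModEightPlus
    (Affine.Point.map (σt : ringClassField K ι 1 →ₐ[K] ringClassField K ι 1)) hT2 (hn₀.mul (hMe.mul hMq)) hZ (hYfix σt hσq)
    (hsigP σt hσq hσp) (hsig σt hσq hσp)
    ⟨kK, hkK, by rw [hcos]; exact hK0⟩
  exact ⟨n₀ * (Me * Mq * Mp), Z, t, hn₀.mul ((hMe.mul hMq).mul hMp), ht, hZ4, hχ⟩

/-! ## §2 The conductor-`1` Heegner trace is non-torsion on the type-α cells `q ≡ 3 (mod 8)`, `(p/q) = +1` — NO `h2` (the χ_Z channel at `σ̃_p`) -/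

/-- **Type α, `q ≡ 3 (mod 8)`, `q > 3`, `p ≡ 1 (mod 4)`, `(p/q) = +1` (a31+ ∪ a35+), NO `h2`: the conductor-`1` trace `Σ_σ σ y₁ ∈ X₀(49)(K[1])` has
INFINITE order** — Z1's `trace_not_isOfFinAddOrder_of_quarterPoint` (lift-agnostic) on §1's quarter point (`χ_Z(σ̃_p) = T`). No descent of `49a1^{(−qp)}`,
no `hBCST`, no `hpar`. [cite: GrossLMS1991, Prop. 5.3] [cite: Gross1984, §§4–5] [cite: CoatesLiTianZhai2015, Thm. 1.3, 1.4, 4.4 and (2.8)] -/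
theorem heegnerTrace_not_isOfFinAddOrder_alpha_threeModEightPlus (hEta₀ : x049_x_sub_two_eq_etaQuotient) (hD : deuring_etaQuotient49_heegner_generates_conjPrime)
    (hEta : x049_heegner_norm_x_sub_two_not_mem) (h14 : thm14_rankOne_twist) (hCST : thm11_ringClassChar)
    (hGZ : ∀ (N : ℕ) [NeZero N] (W : WeierstrassCurve ℚ) (K : Type) [Field K] [NumberField K], gross_zagier N W K)
    (h12 : thm12_fullBSD_twist) (h44 : thm44_ord_two_LAlg)
    (hS31 : bsdTriple_of_rank_le_one_of_conductor_lt) (hnew : exists_isNewformOf)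
    (hBT : burungaleTian_analyticRank_eq_zero_of_selmerCorank_eq_zero_of_hasCM) (hBF : bsdTriple_of_hasCM_of_L_one_ne_zero)
    (hGZK : rank_eq_analyticRank_of_analyticRank_le_one)
    (hK : IsImaginaryQuadratic K) {q p : ℕ} (hq : q.Prime) (hq8 : q % 8 = 3) (h3 : 3 < q) (hq7 : jacobiSym q 7 = -1)
    [Fact p.Prime] (hp4 : p % 4 = 1) (hp7 : legendreSym p (-7) = 1) (hα : ¬ ∃ x : ZMod p, x ^ 4 = -7)
    (hpq : jacobiSym (p : ℤ) q = 1)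
    (hA : ∀ (K₂ : Type) [Field K₂] [NumberField K₂], IsImaginaryQuadratic K₂ → NumberField.discr K₂ = -(8 * (q : ℤ)) →
      ∀ P : (cm7.baseChange K₂).toAffine.Point, IsHeegnerPoint 49 cm7 K₂ P → ¬ IsOfFinAddOrder P)
    (har : ∀ (W : WeierstrassCurve ℚ) [W.IsElliptic] (C : VariableChange ℚ),
      C • W = cm7.quadraticTwist ((-2 * q : ℤ) : ℚ) → W.analyticRank = 1)
    (hdK : NumberField.discr K = -(8 * (q : ℤ) * p))
    (D₀ : ModularParametrizationData cm7 49) (hc : |D₀.c| = 1) (hw : cm7.rootNumber = 1)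
    (h0 : ∃ h, D₀.cuspZeroPoint = Affine.Point.some 2 (-1) h)
    {β : ℤ} (d : KolyvaginHeegnerData D₀ β ι 1) {rq rp : ringClassField K ι 1}
    (hrq : (rq : ℂ) ^ 2 = -(q : ℂ)) (hrp : (rp : ℂ) ^ 2 = (p : ℂ))
    (B : AddSubgroup (cm7.baseChange ℂ).toAffine.Point) (S : Subfield ℂ)
    (hBfix : ∀ P : (cm7.baseChange (ringClassField K ι 1)).toAffine.Point,
      (∀ σ : ringClassField K ι 1 ≃ₐ[K] ringClassField K ι 1, σ rq = rq → σ rp = rp →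
        Affine.Point.map (σ : ringClassField K ι 1 →ₐ[K] ringClassField K ι 1) P = P) →
      Affine.Point.map (W' := cm7) (ringClassField K ι 1).subtype.toRatAlgHom P ∈ B)
    (hBodd : ∀ u ∈ B, IsOfFinAddOrder u → ∃ n : ℤ, Odd n ∧
      (n • u = 0 ∨ n • u = Affine.Point.some 2 (-1) (nonsingular_cm7_baseChange_two_neg_one ℂ)))
    (hBS : ∀ (E : Type) [Field E] [CharZero E] (e : E →+* ℂ), e.fieldRange ≤ S →
      ∀ z : (cm7.baseChange E).toAffine.Point, Affine.Point.map (W' := cm7) e.toRatAlgHom z ∈ B)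
    (hSK : ∀ k : K, ι k ∈ S) (hSq : (rq : ℂ) ∈ S) (hSp : (rp : ℂ) ∈ S)
    (hBL : ∀ z ∈ B, ∃ P : (cm7.baseChange (ringClassField K ι 1)).toAffine.Point,
      Affine.Point.map (W' := cm7) (ringClassField K ι 1).subtype.toRatAlgHom P = z)
    (h7 : ¬ IsSquare (-7 : ringClassField K ι 1)) (h7' : ¬ IsSquare (7 : ringClassField K ι 1))
    (σt : ringClassField K ι 1 ≃ₐ[K] ringClassField K ι 1) (hσq : σt rq = rq) (hσp : σt rp = -rp) :
    ¬ IsOfFinAddOrder (∑ σ : ringClassField K ι 1 ≃ₐ[K] ringClassField K ι 1,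
        Affine.Point.map (σ : ringClassField K ι 1 →ₐ[K] ringClassField K ι 1) d.y) := by
  obtain ⟨N, Z, t, -, ht, hZ4, hχ⟩ := exists_quarterPoint_chiZ_alpha_threeModEightPlus ι hEta₀ hD hEta h14 hCST hGZ h12 h44 hS31 hnew hBT hBF hGZK hK hq
    hq8 h3 hq7 hp4 hp7 hα hpq hA har hdK D₀ hc hw h0 d hrq hrp B S hBfix hBodd hBS hSK hSq hSp hBL h7 h7' σt hσq hσp
  exact trace_not_isOfFinAddOrder_of_quarterPoint hEta hK ι D₀ hc d σt ht hZ4 hχ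

end QuarterPoint

end Summit.BirchSwinnertonDyer.BirchSwinnertonDyer.Theorems.GoldfeldGoodTwists

end
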